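import Summits.BirchSwinnertonDyer.BirchSwinnertonDyer.Theorems.GenusKolyvaginAtTwoK4NegBetaFrameDeepPrimeOneBit
import HarnessLib

/-!
# Route `GenusKolyvaginAtTwo`, crux K₄⁻ `K4Neg` (stmt-BirchSwinnertonDyer-31526), the (β)-residual F4ᶠ —
# TOP-BIT VISIBILITY at deep primes for quarter-points of an entangled half (file 2 of 2)

Width seat `bsd-line-gk2-p5` g43 (cell `bsd-f1-sign2`), WIDTH-5 attach on route `GenusKolyvaginAtTwo` rev 59, lane «the (β)-residual of
K₄⁻».  `--supports stmt-BirchSwinnertonDyer-31526 --as helper`.  THEOREMS ONLY (no definition, no named fact, no `sorry`); standard axioms.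
**BSD is NOT proved by this file; `K4Neg` is NOT proved; no item is closed by it.**

File 1 (`…K4NegBetaFrameDeepPrimeOneBit`) proved the ONE-BIT LAW: for `g ∈ Γ_ℚ` with `g·g = 1` on `E[4]`, `g ≠ 1` on `E[2]` (a deep
Kolyvagin prime's Frobenius), `g·R = ∓R`, `Q'` a half of `R` with `g·g·Q' = Q'` (ENTANGLED half, the (β)-frame datum) and `Q` a half of
`Q'`, the point `g·g·Q − Q` (= the localisation of the level-`4` Kummer class of `R` at `λ`, `Frob_λ = g·g`) lies in `{0, e + g·e}`.
THIS FILE: which of the two values occurs, as `g` runs through its coset modulo `Γ_{ℚ(E[4],Q')}` (the Frobenius classes Čebotarev offers).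

* §1 ★★ **FLIP LAW** (`conj_sq_smul_sub_eq_of_smul_eq_neg` / `…_self`): for `γ ∈ Γ_ℚ` fixing `E[4]` and `Q'`,
  **`(gγ)·(gγ)·Q − Q = (g·g·Q − Q) + (e_γ + g·e_γ)`, `e_γ := γ·Q − Q ∈ E[2]`** — the cocycle identity `[x,(gγ)²] = [x,g²] + (1+g)[x,γ]`
  of the level-`4` Kummer class `x` of `R`, in points; ★★ DICHOTOMY (`conj_sq_smul_sub_eq_iff_…`): the bit at `gγ` equals the bit at
  `g` iff `g` fixes `e_γ`, i.e. it FLIPS exactly when `e_γ ∉ E[2]^g = {0, e + g·e}`.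
* §2 ★★★ **BOTH BIT VALUES OCCUR** (`exists_conj_sq_smul_sub_ne_of_smul_eq_neg` / `…_self`): if `Q` is not fixed by
  `Γ_{ℚ(E[4],Q')}` (the level-`4` class of `R` is not a phantom there — automatic on a (β)-frame, where its double is `ι ξ_E ≠ 0`) and no
  non-zero `2`-torsion point is fixed by every stabiliser of `R` (`E(K)[2] = 0`; in the plus case just ρ̄₂ onto), then some `γ` fixing
  `E[4]` and `Q'` FLIPS the bit (`Γ`-equivariance `(σγσ⁻¹)·Q − Q = σ·(γ·Q − Q)` for stabilisers `σ` of `R`, `conj_smul_sub_eq`).  By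
  Čebotarev (not invoked here) each bit value then has density `½` among the deep Frobenius classes.

READING (census of the (β) residual; nothing closed).  The deep Kolyvagin primes of K4Neg are blind to the phantom `ξ_E` (gk2-p4's trace
bit) but SEE the top bit of each of its halvings: a (β)-frame derived class `c(ℓ)` with top bit set (⟺ `P(ℓ) ∉ 2E(K[ℓ])`) is detected by
half of the deep primes `ℓ′` (`c(ℓℓ′)` ramified at `λ′`); the obstruction «one bit short» of LINE 37 stub P / F4ᶠ is exactly and only the
FIRST step `[c(ℓ)]_s ↔ loc_λ c(1) = loc_λ ι ξ_E = 0`.  No claim on K4Neg|(β) itself.  BSD is NOT proved by any of this.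

References: [GrossLMS1991] §9 (pairing after Prop. 9.1), Prop. 9.1, 9.6; [McCallumLMS1991] §3 (2)–(3), Cor. 3.2; [MazurRubin2010] Lemma 3.5;
[MazurRubin2004] §3.1, §4.1; [LawsonWuthrich2016] §3, §7.1.
-/

set_option linter.dupNamespace false -- `Summit.<P>.<Sub>` repeats `BirchSwinnertonDyer` (D-0017)
set_option autoImplicit false

noncomputable section

open scoped Classical Pointwise

namespace Summit.BirchSwinnertonDyer.BirchSwinnertonDyer.Theorems.GenusExact.Lw2PhantomExclusion.DeepPrimeOneBit

open WeierstrassCurve Field NumberField IsDedekindDomain Matrix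
open Literature.NumberTheory.GaloisRepresentations Literature.NumberTheory.EllipticCurves
open Literature.NumberTheory
open Rat.HeightOneSpectrum (primesEquiv)
open Summit.BirchSwinnertonDyer.BirchSwinnertonDyer.Theorems.GenusKolyTwistingPrime


variable (W : WeierstrassCurve ℚ) [W.IsElliptic]

/-! ## §1 ★★ The flip law along the coset `g·Γ_{ℚ(E[4], Q')}` -/

omit [W.IsElliptic] in
/-- `γ·Q − Q` is killed by `2` when `γ` fixes the double `Q'` of `Q`. [folklore] -/
theorem two_zsmul_smul_sub_eq_zero {γ : absoluteGaloisGroup ℚ} {Q Q' : geomPoints W}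
    (hQ : (2 : ℤ) • Q = Q') (hγQ' : γ • Q' = Q') : (2 : ℤ) • (γ • Q - Q) = 0 := by
  rw [zsmul_sub, smul_comm (2 : ℤ) γ Q, hQ, hγQ', sub_self]

omit [W.IsElliptic] in
/-- `γ·Q − Q` is killed by `4` when `γ` fixes `R = 2Q'`, `Q' = 2Q`. [folklore] -/
theorem four_zsmul_smul_sub_eq_zero {γ : absoluteGaloisGroup ℚ} {R Q' Q : geomPoints W}
    (hQ' : (2 : ℤ) • Q' = R) (hQ : (2 : ℤ) • Q = Q') (hγR : γ • R = R) : (4 : ℤ) • (γ • Q - Q) = 0 := by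
  have h4Q : (4 : ℤ) • Q = R := by
    rw [show (4 : ℤ) = 2 * 2 by norm_num, mul_smul, hQ, hQ']
  rw [smul_sub, smul_comm (4 : ℤ) γ Q, h4Q, hγR, sub_self]

omit [W.IsElliptic] in
/-- An element fixing `Q'` fixes `R = 2Q'`. [folklore] -/
theorem smul_eq_self_of_smul_half_eq_self {γ : absoluteGaloisGroup ℚ} {R Q' : geomPoints W}
    (hQ' : (2 : ℤ) • Q' = R) (hγQ' : γ • Q' = Q') : γ • R = R := by
  rw [← hQ', smul_comm γ (2 : ℤ) Q', hγQ']

omit [W.IsElliptic] in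
/-- ★★ **THE FLIP LAW (minus case).**  With the data of the one-bit law and `γ ∈ Γ_ℚ` fixing `E[4]` and `Q'`:
**`(gγ)·(gγ)·Q − Q = (g·g·Q − Q) + ((γ·Q − Q) + g·(γ·Q − Q))`** — the cocycle identity `[x,(gγ)²] = [x,g²] + (1+g)[x,γ]` for the
level-`4` Kummer class of `R`, in points. [cite: GrossLMS1991, §9 (pairing after Prop. 9.1)] [cite: McCallumLMS1991, §3 (2)] -/
theorem conj_sq_smul_sub_eq_of_smul_eq_neg {g γ : absoluteGaloisGroup ℚ}
    (hg4 : ∀ P : geomPoints W, (4 : ℤ) • P = 0 → g • g • P = P)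
    (hγ4 : ∀ P : geomPoints W, (4 : ℤ) • P = 0 → γ • P = P)
    {R Q' Q : geomPoints W} (hR : g • R = -R) (hQ' : (2 : ℤ) • Q' = R) (hQ : (2 : ℤ) • Q = Q')
    (hγQ' : γ • Q' = Q') :
    (g * γ) • (g * γ) • Q - Q = (g • g • Q - Q) + ((γ • Q - Q) + g • (γ • Q - Q)) := by
  have hγR : γ • R = R := smul_eq_self_of_smul_half_eq_self W hQ' hγQ'
  -- `e := γ·Q − Q ∈ E[4]` (indeed `E[2]`), `t := g·Q + Q ∈ E[4]`
  have he4 : (4 : ℤ) • (γ • Q - Q) = 0 := four_zsmul_smul_sub_eq_zero W hQ' hQ hγR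
  have he2 : (2 : ℤ) • (γ • Q - Q) = 0 := two_zsmul_smul_sub_eq_zero W hQ hγQ'
  have h4Q : (4 : ℤ) • Q = R := by
    rw [show (4 : ℤ) = 2 * 2 by norm_num, mul_smul, hQ, hQ']
  have ht4 : (4 : ℤ) • (g • Q + Q) = 0 := by
    rw [smul_add, smul_comm (4 : ℤ) g Q, h4Q, hR, neg_add_cancel]
  have hγt : γ • (g • Q + Q) = g • Q + Q := hγ4 _ ht4
  have hge4 : (4 : ℤ) • (g • (γ • Q - Q)) = 0 := by rw [smul_comm, he4, smul_zero]
  have hγge : γ • g • (γ • Q - Q) = g • (γ • Q - Q) := hγ4 _ hge4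
  have hgge : g • g • (γ • Q - Q) = γ • Q - Q := hg4 _ he4
  -- `γ·Q = Q + e`
  have hγQ : γ • Q = Q + (γ • Q - Q) := by abel
  -- `γ·g·Q = g·Q − e`:  `g·Q = t − Q`, `γ·(t − Q) = t − Q − e`
  have hγgQ : γ • g • Q = g • Q - (γ • Q - Q) := by
    have h1 : g • Q = (g • Q + Q) - Q := by abel
    rw [h1, smul_sub, hγt]
    abel
  -- assemble
  have hneg : -(g • (γ • Q - Q)) = g • (γ • Q - Q) := by
    apply neg_eq_self_of_two_zsmul_eq_zero W
    rw [smul_comm, he2, smul_zero]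
  calc (g * γ) • (g * γ) • Q - Q
      = g • γ • g • γ • Q - Q := by rw [mul_smul, mul_smul]
    _ = g • γ • g • (Q + (γ • Q - Q)) - Q := by rw [← hγQ]
    _ = g • γ • (g • Q + g • (γ • Q - Q)) - Q := by rw [smul_add]
    _ = g • (γ • g • Q + γ • g • (γ • Q - Q)) - Q := by rw [smul_add]
    _ = g • (g • Q - (γ • Q - Q) + g • (γ • Q - Q)) - Q := by rw [hγgQ, hγge]
    _ = g • g • Q - g • (γ • Q - Q) + g • g • (γ • Q - Q) - Q := by rw [smul_add, smul_sub]
    _ = (g • g • Q - Q) + ((γ • Q - Q) + -(g • (γ • Q - Q))) := by rw [hgge]; abel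
    _ = (g • g • Q - Q) + ((γ • Q - Q) + g • (γ • Q - Q)) := by rw [hneg]

omit [W.IsElliptic] in
/-- ★★ **THE FLIP LAW (plus case)**: the same with `g·R = R`. [cite: GrossLMS1991, §9 (pairing after Prop. 9.1)] [cite: McCallumLMS1991, §3 (2)] -/
theorem conj_sq_smul_sub_eq_of_smul_eq_self {g γ : absoluteGaloisGroup ℚ}
    (hg4 : ∀ P : geomPoints W, (4 : ℤ) • P = 0 → g • g • P = P)
    (hγ4 : ∀ P : geomPoints W, (4 : ℤ) • P = 0 → γ • P = P)
    {R Q' Q : geomPoints W} (hR : g • R = R) (hQ' : (2 : ℤ) • Q' = R) (hQ : (2 : ℤ) • Q = Q')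
    (hγQ' : γ • Q' = Q') :
    (g * γ) • (g * γ) • Q - Q = (g • g • Q - Q) + ((γ • Q - Q) + g • (γ • Q - Q)) := by
  have hγR : γ • R = R := smul_eq_self_of_smul_half_eq_self W hQ' hγQ'
  have he4 : (4 : ℤ) • (γ • Q - Q) = 0 := four_zsmul_smul_sub_eq_zero W hQ' hQ hγR
  have h4Q : (4 : ℤ) • Q = R := by
    rw [show (4 : ℤ) = 2 * 2 by norm_num, mul_smul, hQ, hQ']
  have ht4 : (4 : ℤ) • (g • Q - Q) = 0 := by
    rw [smul_sub, smul_comm (4 : ℤ) g Q, h4Q, hR, sub_self]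
  have hγt : γ • (g • Q - Q) = g • Q - Q := hγ4 _ ht4
  have hge4 : (4 : ℤ) • (g • (γ • Q - Q)) = 0 := by rw [smul_comm, he4, smul_zero]
  have hγge : γ • g • (γ • Q - Q) = g • (γ • Q - Q) := hγ4 _ hge4
  have hgge : g • g • (γ • Q - Q) = γ • Q - Q := hg4 _ he4
  have hγQ : γ • Q = Q + (γ • Q - Q) := by abel
  -- `γ·g·Q = g·Q + e`:  `g·Q = Q + t`, `γ·(Q + t) = Q + e + t`
  have hγgQ : γ • g • Q = g • Q + (γ • Q - Q) := by
    have h1 : g • Q = Q + (g • Q - Q) := by abel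
    rw [h1, smul_add, hγt]
    abel
  calc (g * γ) • (g * γ) • Q - Q
      = g • γ • g • γ • Q - Q := by rw [mul_smul, mul_smul]
    _ = g • γ • g • (Q + (γ • Q - Q)) - Q := by rw [← hγQ]
    _ = g • γ • (g • Q + g • (γ • Q - Q)) - Q := by rw [smul_add]
    _ = g • (γ • g • Q + γ • g • (γ • Q - Q)) - Q := by rw [smul_add]
    _ = g • (g • Q + (γ • Q - Q) + g • (γ • Q - Q)) - Q := by rw [hγgQ, hγge]
    _ = g • g • Q + g • (γ • Q - Q) + g • g • (γ • Q - Q) - Q := by rw [smul_add, smul_add]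
    _ = (g • g • Q - Q) + ((γ • Q - Q) + g • (γ • Q - Q)) := by rw [hgge]; abel

omit [W.IsElliptic] in
/-- **For a point `e` killed by `2`: `e + g·e = 0 ⟺ g·e = e`.** [folklore] -/
theorem add_smul_eq_zero_iff_of_two_zsmul_eq_zero {g : absoluteGaloisGroup ℚ} {e : geomPoints W} (he : (2 : ℤ) • e = 0) :
    e + g • e = 0 ↔ g • e = e := by
  constructor
  · intro h
    have h1 : g • e = -e := (neg_eq_of_add_eq_zero_right h).symm
    rw [h1, neg_eq_self_of_two_zsmul_eq_zero W he]
  · intro h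
    rw [h, ← two_zsmul]
    exact_mod_cast he

omit [W.IsElliptic] in
/-- ★★ **DICHOTOMY.**  Under the flip law, the bit at `gγ` equals the bit at `g` iff `g` fixes `e_γ = γ·Q − Q`; i.e. the bit FLIPS exactly
when `e_γ ∉ E[2]^g`. (Minus case.) [cite: GrossLMS1991, §9 Prop. 9.6] [cite: McCallumLMS1991, §3 (3)] -/
theorem conj_sq_smul_sub_eq_iff_of_smul_eq_neg {g γ : absoluteGaloisGroup ℚ}
    (hg4 : ∀ P : geomPoints W, (4 : ℤ) • P = 0 → g • g • P = P)
    (hγ4 : ∀ P : geomPoints W, (4 : ℤ) • P = 0 → γ • P = P)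
    {R Q' Q : geomPoints W} (hR : g • R = -R) (hQ' : (2 : ℤ) • Q' = R) (hQ : (2 : ℤ) • Q = Q')
    (hγQ' : γ • Q' = Q') :
    (g * γ) • (g * γ) • Q - Q = g • g • Q - Q ↔ g • (γ • Q - Q) = γ • Q - Q := by
  rw [conj_sq_smul_sub_eq_of_smul_eq_neg W hg4 hγ4 hR hQ' hQ hγQ', add_eq_left,
    add_smul_eq_zero_iff_of_two_zsmul_eq_zero W (two_zsmul_smul_sub_eq_zero W hQ hγQ')]

omit [W.IsElliptic] in
/-- ★★ **DICHOTOMY (plus case).** [cite: GrossLMS1991, §9 Prop. 9.6] [cite: McCallumLMS1991, §3 (3)] -/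
theorem conj_sq_smul_sub_eq_iff_of_smul_eq_self {g γ : absoluteGaloisGroup ℚ}
    (hg4 : ∀ P : geomPoints W, (4 : ℤ) • P = 0 → g • g • P = P)
    (hγ4 : ∀ P : geomPoints W, (4 : ℤ) • P = 0 → γ • P = P)
    {R Q' Q : geomPoints W} (hR : g • R = R) (hQ' : (2 : ℤ) • Q' = R) (hQ : (2 : ℤ) • Q = Q')
    (hγQ' : γ • Q' = Q') :
    (g * γ) • (g * γ) • Q - Q = g • g • Q - Q ↔ g • (γ • Q - Q) = γ • Q - Q := by
  rw [conj_sq_smul_sub_eq_of_smul_eq_self W hg4 hγ4 hR hQ' hQ hγQ', add_eq_left,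
    add_smul_eq_zero_iff_of_two_zsmul_eq_zero W (two_zsmul_smul_sub_eq_zero W hQ hγQ')]

omit [W.IsElliptic] in
/-- **Conjugating a `Γ_{ℚ(E[4],Q')}`-element by a stabiliser of `R`** keeps it in `Γ_{ℚ(E[4],Q')}` and moves its value `γ·Q − Q` by `σ`:
for `σ·R = R`, `γ` fixing `E[4]` and `Q'`, the conjugate `σγσ⁻¹` fixes `E[4]` and `Q'`, and `(σγσ⁻¹)·Q − Q = σ·(γ·Q − Q)` (the
`Γ`-equivariance `[x, γ^σ] = σ[x, γ]` of Gross §9, in points: `σ⁻¹·Q` and `σ⁻¹·Q'` differ from `Q`, `Q'` by points of `E[4]`).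
[cite: GrossLMS1991, §9 (pairing after Prop. 9.1)] -/
theorem conj_smul_sub_eq {σ γ : absoluteGaloisGroup ℚ} (hγ4 : ∀ P : geomPoints W, (4 : ℤ) • P = 0 → γ • P = P)
    {R Q' Q : geomPoints W} (hQ' : (2 : ℤ) • Q' = R) (hQ : (2 : ℤ) • Q = Q') (hγQ' : γ • Q' = Q') (hσR : σ • R = R) :
    (∀ P : geomPoints W, (4 : ℤ) • P = 0 → (σ * γ * σ⁻¹) • P = P) ∧ (σ * γ * σ⁻¹) • Q' = Q' ∧
      (σ * γ * σ⁻¹) • Q - Q = σ • (γ • Q - Q) := by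
  have hσR' : σ⁻¹ • R = R := by
    rw [inv_smul_eq_iff, hσR]
  have h4Q : (4 : ℤ) • Q = R := by
    rw [show (4 : ℤ) = 2 * 2 by norm_num, mul_smul, hQ, hQ']
  refine ⟨fun P hP ↦ ?_, ?_, ?_⟩
  · have hP' : (4 : ℤ) • (σ⁻¹ • P) = 0 := by rw [smul_comm, hP, smul_zero]
    rw [mul_smul, mul_smul, hγ4 _ hP', smul_inv_smul]
  · -- `f' := σ⁻¹·Q' − Q'` is killed by `2`, hence by `4`; `γ` fixes it
    have hf' : (4 : ℤ) • (σ⁻¹ • Q' - Q') = 0 := by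
      rw [show (4 : ℤ) = 2 * 2 by norm_num, mul_smul, smul_sub, smul_comm (2 : ℤ) σ⁻¹ Q', hQ', hσR', sub_self, smul_zero]
    have hγf' : γ • (σ⁻¹ • Q' - Q') = σ⁻¹ • Q' - Q' := hγ4 _ hf'
    have h1 : σ⁻¹ • Q' = Q' + (σ⁻¹ • Q' - Q') := by abel
    rw [mul_smul, mul_smul, h1, smul_add, hγQ', hγf', ← h1, smul_inv_smul]
  · -- `f := σ⁻¹·Q − Q` is killed by `4`; `γ` fixes it
    have hf : (4 : ℤ) • (σ⁻¹ • Q - Q) = 0 := by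
      rw [smul_sub, smul_comm (4 : ℤ) σ⁻¹ Q, h4Q, hσR', sub_self]
    have hγf : γ • (σ⁻¹ • Q - Q) = σ⁻¹ • Q - Q := hγ4 _ hf
    have h1 : σ⁻¹ • Q = Q + (σ⁻¹ • Q - Q) := by abel
    have h2 : γ • σ⁻¹ • Q = (γ • Q - Q) + σ⁻¹ • Q := by
      rw [h1, smul_add, hγf]; abel
    rw [mul_smul, mul_smul, h2, smul_add, smul_inv_smul]
    abel

/-! ## §2 ★★★ Both bit values occur -/

/-- ★★★ **TOP-BIT VISIBILITY — both bit values occur (minus case).**  Data of the one-bit law (`g·g = 1` on `E[4]`, `g·e ≠ e` for some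
`e ∈ E[2]`, `g·R = −R`, `2Q' = R`, `g·g·Q' = Q'`, `2Q = Q'`).  Suppose (i) `Q` is NOT fixed by `Γ_{ℚ(E[4],Q')}`: some `γ₀` fixing `E[4]`
and `Q'` moves `Q` (the level-`4` Kummer class of `R` does not die there — `R` is not `4`-divisible over `ℚ(E[4], Q')`; automatic on a
(β)-frame, where a class with double `ι ξ_E ≠ 0` is never a level-`4` phantom), and (ii) no non-zero point killed by `2` is fixed by every
stabiliser of `R` (on a frame: `E(K)[2] = 0`, the stabiliser contains `Γ_K`).  Then some `γ` fixing `E[4]` and `Q'` has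
**`(gγ)·(gγ)·Q − Q ≠ g·g·Q − Q`** — the bit FLIPS on the coset `g·Γ_{ℚ(E[4],Q')}` (and trivially `γ = 1` keeps it), so by Čebotarev half of
the deep Frobenius classes SEE the top bit of the entangled half's quarter-points. [cite: GrossLMS1991, §9 Prop. 9.1, 9.6]
[cite: MazurRubin2010, Lemma 3.5] [cite: McCallumLMS1991, §3 Cor. 3.2] -/
theorem exists_conj_sq_smul_sub_ne_of_smul_eq_neg {g : absoluteGaloisGroup ℚ}
    (hg4 : ∀ P : geomPoints W, (4 : ℤ) • P = 0 → g • g • P = P)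
    (hge : ∃ e : geomPoints W, (2 : ℤ) • e = 0 ∧ g • e ≠ e)
    {R Q' Q : geomPoints W} (hR : g • R = -R) (hQ' : (2 : ℤ) • Q' = R) (hQ : (2 : ℤ) • Q = Q')
    (hN : ∃ γ₀ : absoluteGaloisGroup ℚ, (∀ P : geomPoints W, (4 : ℤ) • P = 0 → γ₀ • P = P) ∧ γ₀ • Q' = Q' ∧ γ₀ • Q ≠ Q)
    (hirr : ∀ m : geomPoints W, (2 : ℤ) • m = 0 → m ≠ 0 → ∃ σ : absoluteGaloisGroup ℚ, σ • R = R ∧ σ • m ≠ m) :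
    ∃ γ : absoluteGaloisGroup ℚ, (∀ P : geomPoints W, (4 : ℤ) • P = 0 → γ • P = P) ∧ γ • Q' = Q' ∧
      (g * γ) • (g * γ) • Q - Q ≠ g • g • Q - Q := by
  obtain ⟨e, he, hge⟩ := hge
  obtain ⟨γ₀, hγ₀4, hγ₀Q', hγ₀Q⟩ := hN
  have hgg : ∀ P : geomPoints W, (2 : ℤ) • P = 0 → g • g • P = P := fun P hP ↦
    hg4 P (by rw [show (4 : ℤ) = 2 * 2 by norm_num, mul_smul, hP, smul_zero])
  have he₀2 : (2 : ℤ) • (γ₀ • Q - Q) = 0 := two_zsmul_smul_sub_eq_zero W hQ hγ₀Q'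
  have he₀0 : γ₀ • Q - Q ≠ 0 := fun h ↦ hγ₀Q (sub_eq_zero.mp h)
  by_cases hfix : g • (γ₀ • Q - Q) = γ₀ • Q - Q
  · -- `e₀ = γ₀·Q − Q` is the non-zero `g`-fixed point `e + g·e`; move it by a stabiliser of `R`
    obtain ⟨σ, hσR, hσe⟩ := hirr _ he₀2 he₀0
    obtain ⟨hγ4, hγQ', hγQ⟩ := conj_smul_sub_eq W hγ₀4 hQ' hQ hγ₀Q' hσR
    refine ⟨σ * γ₀ * σ⁻¹, hγ4, hγQ', fun h ↦ ?_⟩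
    rw [conj_sq_smul_sub_eq_iff_of_smul_eq_neg W hg4 hγ4 hR hQ' hQ hγQ', hγQ] at h
    -- `σ·e₀` is `g`-fixed, killed by `2`, non-zero: it is `e + g·e = e₀`, contradiction
    have hσe2 : (2 : ℤ) • (σ • (γ₀ • Q - Q)) = 0 := by rw [smul_comm, he₀2, smul_zero]
    have hσe0 : σ • (γ₀ • Q - Q) ≠ 0 := fun h0 ↦ he₀0 (by
      have := congrArg (fun P ↦ σ⁻¹ • P) h0
      simpa only [inv_smul_smul, smul_zero] using this)
    have h1 := two_torsion_fixed_eq_zero_or_eq_add W hgg he hge hσe2 h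
    have h2 := two_torsion_fixed_eq_zero_or_eq_add W hgg he hge he₀2 hfix
    rcases h1 with h1 | h1
    · exact hσe0 h1
    rcases h2 with h2 | h2
    · exact he₀0 h2
    exact hσe (by rw [h1, ← h2])
  · exact ⟨γ₀, hγ₀4, hγ₀Q', fun h ↦ hfix ((conj_sq_smul_sub_eq_iff_of_smul_eq_neg W hg4 hγ₀4 hR hQ' hQ hγ₀Q').mp h)⟩

/-- ★★★ **TOP-BIT VISIBILITY — both bit values occur (plus case; `R` rational on the curve read, e.g. the twin's generator on the twin):
here (ii) is just «no non-zero rational `2`-torsion» in the form `eq_zero_of_forall_smul_eq` (ρ̄₂ onto).** [cite: GrossLMS1991, §9 Prop. 9.1, 9.6]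
[cite: MazurRubin2010, Lemma 3.5] -/
theorem exists_conj_sq_smul_sub_ne_of_smul_eq_self (hsurj : W.HasSurjectiveModNGaloisRep 2) {g : absoluteGaloisGroup ℚ}
    (hg4 : ∀ P : geomPoints W, (4 : ℤ) • P = 0 → g • g • P = P)
    (hge : ∃ e : geomPoints W, (2 : ℤ) • e = 0 ∧ g • e ≠ e)
    {R Q' Q : geomPoints W} (hR : ∀ σ : absoluteGaloisGroup ℚ, σ • R = R) (hQ' : (2 : ℤ) • Q' = R) (hQ : (2 : ℤ) • Q = Q')
    (hN : ∃ γ₀ : absoluteGaloisGroup ℚ, (∀ P : geomPoints W, (4 : ℤ) • P = 0 → γ₀ • P = P) ∧ γ₀ • Q' = Q' ∧ γ₀ • Q ≠ Q) :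
    ∃ γ : absoluteGaloisGroup ℚ, (∀ P : geomPoints W, (4 : ℤ) • P = 0 → γ • P = P) ∧ γ • Q' = Q' ∧
      (g * γ) • (g * γ) • Q - Q ≠ g • g • Q - Q := by
  obtain ⟨e, he, hge⟩ := hge
  obtain ⟨γ₀, hγ₀4, hγ₀Q', hγ₀Q⟩ := hN
  have hgg : ∀ P : geomPoints W, (2 : ℤ) • P = 0 → g • g • P = P := fun P hP ↦
    hg4 P (by rw [show (4 : ℤ) = 2 * 2 by norm_num, mul_smul, hP, smul_zero])
  -- (ii): no non-zero `Γ_ℚ`-fixed `2`-torsion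
  have hirr : ∀ m : geomPoints W, (2 : ℤ) • m = 0 → m ≠ 0 → ∃ σ : absoluteGaloisGroup ℚ, σ • R = R ∧ σ • m ≠ m := by
    intro m hm hm0
    by_contra hcon
    push Not at hcon
    have hmT : m ∈ geomTorsion W (2 : ℤ) := (WeierstrassCurve.mem_geomTorsion_iff W (2 : ℤ) m).mpr hm
    have h0 : (⟨m, hmT⟩ : geomTorsion W (2 : ℤ)) = 0 :=
      eq_zero_of_forall_smul_eq W hsurj fun σ ↦ Subtype.ext (by
        rw [AddSubgroup.torsionBy.coe_smul]; exact hcon σ (hR σ))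
    exact hm0 (by simpa using congrArg Subtype.val h0)
  have he₀2 : (2 : ℤ) • (γ₀ • Q - Q) = 0 := two_zsmul_smul_sub_eq_zero W hQ hγ₀Q'
  have he₀0 : γ₀ • Q - Q ≠ 0 := fun h ↦ hγ₀Q (sub_eq_zero.mp h)
  by_cases hfix : g • (γ₀ • Q - Q) = γ₀ • Q - Q
  · obtain ⟨σ, hσR, hσe⟩ := hirr _ he₀2 he₀0
    obtain ⟨hγ4, hγQ', hγQ⟩ := conj_smul_sub_eq W hγ₀4 hQ' hQ hγ₀Q' hσR
    refine ⟨σ * γ₀ * σ⁻¹, hγ4, hγQ', fun h ↦ ?_⟩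
    rw [conj_sq_smul_sub_eq_iff_of_smul_eq_self W hg4 hγ4 (hR g) hQ' hQ hγQ', hγQ] at h
    have hσe2 : (2 : ℤ) • (σ • (γ₀ • Q - Q)) = 0 := by rw [smul_comm, he₀2, smul_zero]
    have hσe0 : σ • (γ₀ • Q - Q) ≠ 0 := fun h0 ↦ he₀0 (by
      have := congrArg (fun P ↦ σ⁻¹ • P) h0
      simpa only [inv_smul_smul, smul_zero] using this)
    have h1 := two_torsion_fixed_eq_zero_or_eq_add W hgg he hge hσe2 h
    have h2 := two_torsion_fixed_eq_zero_or_eq_add W hgg he hge he₀2 hfix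
    rcases h1 with h1 | h1
    · exact hσe0 h1
    rcases h2 with h2 | h2
    · exact he₀0 h2
    exact hσe (by rw [h1, ← h2])
  · exact ⟨γ₀, hγ₀4, hγ₀Q', fun h ↦ hfix ((conj_sq_smul_sub_eq_iff_of_smul_eq_self W hg4 hγ₀4 (hR g) hQ' hQ hγ₀Q').mp h)⟩

/-! ## §3 The cohomological reading: `g·g·Q − Q = [κ₄, g·g]` for the level-`4` Kummer class `κ₄` of a rational `R` -/

omit [W.IsElliptic] in
/-- **`g·g·Q − Q` IS the value `[κ₄(R), g·g]`** of the level-`4` Kummer class `κ₄(R) = [σ ↦ σQ − Q] ∈ H¹(ℚ, E[4])` (`4Q = R` rational;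
plus case — e.g. the twin's generator on the twin) at `g·g ∈ Γ_{ℚ(E[4])}`; hence the ONE-BIT LAW of file 1 reads
**`[κ₄(R), g·g] ∈ {0, e + g·e}`** (the localisation of `κ₄(R)` at the deep prime, `H¹_ur(K_λ, E[4]) = E[4]`, is one bit).
[cite: GrossLMS1991, §9 (pairing after Prop. 9.1), Prop. 9.6] [cite: SilvermanAEC2009, VIII.§2] -/
theorem coe_h1Eval_kummerClassTorsion_sq_eq {g : absoluteGaloisGroup ℚ}
    (hg4 : ∀ P : geomPoints W, (4 : ℤ) • P = 0 → g • g • P = P)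
    (Q : geomPoints W) (hQ4 : (4 : ℤ) • Q ∈ MulAction.fixedPoints (absoluteGaloisGroup ℚ) (geomPoints W)) :
    g * g ∈ torsionFixing W (4 : ℤ) ∧
      ((h1Eval W (4 : ℤ) (W.kummerClassTorsion (4 : ℤ) Q hQ4) (g * g) : geomTorsion W (4 : ℤ)) : geomPoints W) = g • g • Q - Q := by
  have hgg : g * g ∈ torsionFixing W (4 : ℤ) := by
    refine (mem_torsionFixing_iff W (4 : ℤ)).mpr fun P ↦ Subtype.ext ?_
    rw [AddSubgroup.torsionBy.coe_smul, mul_smul]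
    exact hg4 _ ((WeierstrassCurve.mem_geomTorsion_iff W (4 : ℤ) _).mp P.2)
  exact ⟨hgg, by rw [coe_h1Eval_kummerClassTorsion W (4 : ℤ) Q hQ4 hgg, mul_smul]⟩

/-- ★ **ONE-BIT LAW in `[·,·]`-currency (plus case).**  `R ∈ E(ℚ̄)^{Γ_ℚ}` with a half `Q'` ENTANGLED at level `4` (`γ·Q' = Q'` for all
`γ ∈ Γ_{ℚ(E[4])}`), `Q` a half of `Q'`, `g·g = 1` on `E[4]`, `g·e ≠ e` on `E[2]`: **`[κ₄(R), g·g] = 0 ∨ [κ₄(R), g·g] = e + g·e`** (as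
points).  [cite: GrossLMS1991, §9 Prop. 9.6] [cite: LawsonWuthrich2016, §3, §7.1] -/
theorem h1Eval_kummerClassTorsion_sq_eq_zero_or_eq {g : absoluteGaloisGroup ℚ}
    (hg4 : ∀ P : geomPoints W, (4 : ℤ) • P = 0 → g • g • P = P)
    {e : geomPoints W} (he : (2 : ℤ) • e = 0) (hge : g • e ≠ e)
    {R Q' Q : geomPoints W} (hR : R ∈ MulAction.fixedPoints (absoluteGaloisGroup ℚ) (geomPoints W))
    (hQ' : (2 : ℤ) • Q' = R) (hQ : (2 : ℤ) • Q = Q') (hent : ∀ γ ∈ torsionFixing W (4 : ℤ), γ • Q' = Q')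
    (hQ4 : (4 : ℤ) • Q ∈ MulAction.fixedPoints (absoluteGaloisGroup ℚ) (geomPoints W)) :
    ((h1Eval W (4 : ℤ) (W.kummerClassTorsion (4 : ℤ) Q hQ4) (g * g) : geomTorsion W (4 : ℤ)) : geomPoints W) = 0 ∨
      ((h1Eval W (4 : ℤ) (W.kummerClassTorsion (4 : ℤ) Q hQ4) (g * g) : geomTorsion W (4 : ℤ)) : geomPoints W) = e + g • e := by
  obtain ⟨hgg, hval⟩ := coe_h1Eval_kummerClassTorsion_sq_eq W hg4 Q hQ4
  rw [hval]
  have hgQ' : g • g • Q' = Q' := by rw [← mul_smul]; exact hent _ hgg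
  exact DeepPrimeOneBit.sq_smul_sub_eq_zero_or_eq_of_smul_eq_self W hg4 he hge (hR g) hQ' hQ hgQ'

omit [W.IsElliptic] in
/-- ★★ **FLIP LAW in `[·,·]`-currency**: `[κ₄(R), (gγ)·(gγ)] = [κ₄(R), g·g] + ([κ₄(R), γ] + g·[κ₄(R), γ])` for `γ ∈ Γ_{ℚ(E[4])}` fixing `Q'`
(the cocycle identity at `(gγ)² = (gγg⁻¹)·g²·(g⁻¹…)`-free form; `R` rational, plus case). [cite: GrossLMS1991, §9 (pairing after Prop. 9.1)]
[cite: McCallumLMS1991, §3 (2)] -/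
theorem coe_h1Eval_kummerClassTorsion_conj_sq_eq {g γ : absoluteGaloisGroup ℚ}
    (hg4 : ∀ P : geomPoints W, (4 : ℤ) • P = 0 → g • g • P = P) (hγ : γ ∈ torsionFixing W (4 : ℤ))
    {R Q' Q : geomPoints W} (hR : R ∈ MulAction.fixedPoints (absoluteGaloisGroup ℚ) (geomPoints W))
    (hQ' : (2 : ℤ) • Q' = R) (hQ : (2 : ℤ) • Q = Q') (hγQ' : γ • Q' = Q')
    (hQ4 : (4 : ℤ) • Q ∈ MulAction.fixedPoints (absoluteGaloisGroup ℚ) (geomPoints W)) :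
    (g * γ) * (g * γ) ∈ torsionFixing W (4 : ℤ) ∧
      ((h1Eval W (4 : ℤ) (W.kummerClassTorsion (4 : ℤ) Q hQ4) ((g * γ) * (g * γ)) : geomTorsion W (4 : ℤ)) : geomPoints W) =
        ((h1Eval W (4 : ℤ) (W.kummerClassTorsion (4 : ℤ) Q hQ4) (g * g) : geomTorsion W (4 : ℤ)) : geomPoints W) +
          ((((h1Eval W (4 : ℤ) (W.kummerClassTorsion (4 : ℤ) Q hQ4) γ : geomTorsion W (4 : ℤ)) : geomPoints W)) +
            g • (((h1Eval W (4 : ℤ) (W.kummerClassTorsion (4 : ℤ) Q hQ4) γ : geomTorsion W (4 : ℤ)) : geomPoints W))) := by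
  have hγ4 : ∀ P : geomPoints W, (4 : ℤ) • P = 0 → γ • P = P := fun P hP ↦ by
    have := smul_eq_of_mem_torsionFixing W (4 : ℤ) hγ ⟨P, (WeierstrassCurve.mem_geomTorsion_iff W (4 : ℤ) P).mpr hP⟩
    simpa only [AddSubgroup.torsionBy.coe_smul] using congrArg Subtype.val this
  have hgγ4 : ∀ P : geomPoints W, (4 : ℤ) • P = 0 → (g * γ) • (g * γ) • P = P := fun P hP ↦ by
    have hP' : (4 : ℤ) • (g • P) = 0 := by rw [smul_comm, hP, smul_zero]
    rw [mul_smul, mul_smul, hγ4 _ hP, hγ4 _ hP']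
    exact hg4 P hP
  obtain ⟨hgg, hval⟩ := coe_h1Eval_kummerClassTorsion_sq_eq W hg4 Q hQ4
  obtain ⟨hgγgγ, hval'⟩ := coe_h1Eval_kummerClassTorsion_sq_eq W hgγ4 Q hQ4
  refine ⟨hgγgγ, ?_⟩
  rw [hval', hval, coe_h1Eval_kummerClassTorsion W (4 : ℤ) Q hQ4 hγ]
  exact DeepPrimeOneBit.conj_sq_smul_sub_eq_of_smul_eq_self W hg4 hγ4 (hR g) hQ' hQ hγQ'


end Summit.BirchSwinnertonDyer.BirchSwinnertonDyer.Theorems.GenusExact.Lw2PhantomExclusion.DeepPrimeOneBit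

end
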